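import Literature.NumberTheory.Automorphic.GL2KirillovInjective
import Literature.NumberTheory.Automorphic.TateGaussSums
import HarnessLib

/-!
# Torus-equivariant functionals on an irreducible generic representation of `GL₂(F)` form a line

Topic `Literature/NumberTheory/Automorphic`; proof file (theorems only).  Let `F` be a
non-archimedean local field, `π` an irreducible smooth representation of `GL₂(F)` on `V`,
`ψ ≠ 1` a continuous additive character and `Λ ≠ 0` a `ψ`-Whittaker functional, with Kirillov
map `v ↦ (a ↦ W_v(d(a, 1)))`, `d(a, 1) = diag(a, 1)` (injective: `kirillov_injective`,
`GL2KirillovInjective`; Jacquet–Langlands 1970, Prop. 2.8 (ii)).  Let `K ⊇ ℂ` be a field and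
`e : Fˣ → K` a function which is `1` on some `U^f = 1 + 𝔭^f` and takes a value `e(t)`
transcendental over `ℂ` at some `t ∈ Fˣ` (the case in point: `K = ℂ(X)`,
`e(b) = χ(b)⁻¹ |b|^{1/2} X^{-ord b}`, the quasi-character through which the torus acts on the zeta
integrals `Ψ(s; W_{π(d(b,1)) v}, χ) = χ(b)⁻¹ |b|^{1/2 - s} Ψ(s; W_v, χ)` read in `X = q^{-s}`).
**Main theorem** (`exists_testVector_forall_torusEquivariant_eq_zero`): there is a vector `w`
whose Kirillov function is the indicator of some `U^M`, `M ≥ max(f, 1)`, such that every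
`ℂ`-linear `Z : V → K` with `Z(π(d(b, 1)) v) = e(b) Z(v)` (`b ∈ Fˣ`, `v ∈ V`) and `Z(w) = 0`
vanishes identically; hence any two such functionals are `K`-proportional
(`torusEquivariant_proportional`).  This is the uniqueness principle behind the local functional
equation of `GL₂ × GL₁` (Jacquet–Langlands 1970, Thm. 2.18 (iv); Jacquet–Piatetski-Shapiro–Shalika
1983, Thm. 2.7 (iii), whose proof rests on the uniqueness of quasi-invariant bilinear forms,
§2.10–2.11), in Bernstein's formulation over the field `ℂ(q^{-s})`.

The proof follows Jacquet–Langlands 1970, Props. 2.8–2.9 (the Kirillov model contains the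
Schwartz space `𝒮(Fˣ)` and `V(N)` is carried onto it) and the finiteness of the Jacquet module:

* `exists_whittakerModel_sum_unipotentGL2_eq_indicator` — Fourier truncation (Prop. 2.9 (i)): for
  a smooth `v`, `a₀ ∈ F` and `r ∈ ℤ` a finite combination `w = ∑_y ψ(-y a₀) π(n(y)) v` has
  `W_w(d(a,1)) = C · 1[a - a₀ ∈ 𝔭^r] · W_v(d(a,1))`, `C ≠ 0` (orthogonality of characters on
  `𝔭^j / 𝔭^{r'}`, `sum_addChar_mul_measureReal_eq`);
* `exists_forall_whittakerModel_diagGL2_eq_indicator_unitFiltration` — vectors `w_j` with Kirillov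
  function `1_{U^j}` for all deep `j`;
* `exists_apply_eq_natCast_mul_of_indicator` — for `j ≤ j'`, `w_j = ∑_{y} π(d((1+y)⁻¹, 1)) w_{j'}`
  over representatives `y` of `𝔭^j / 𝔭^{j'}` (Kirillov injectivity), so
  `Z(w_j) = [U^j : U^{j'}] Z(w_{j'})` for `Z` as above;
* `torusEquivariant_apply_eq_zero_of_mem_ker` — if `Z(w_M) = 0` then `Z` kills
  `V(N) = ker (V → V_N)`: the Kirillov function of `v ∈ V(N)` is locally constant with support in
  an annulus (`exists_whittakerModel_diagGL2_eq_zero_of_mem_ker`, `…_of_not_mem`), hence `v` is a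
  finite combination of torus translates of the `w_j` (Kirillov injectivity again);
* `torusEquivariant_eq_zero_of_forall_mem_ker` — the Jacquet-module step: `Z` factors through the
  finite-dimensional `V_N`, on which `d(t, 1)` has a characteristic polynomial `p`
  (Cayley–Hamilton), so `p(e(t)) Z = 0` with `p(e(t)) ≠ 0` by transcendence.

## References

* H. Jacquet, R. P. Langlands, *Automorphic Forms on GL(2)*, LNM 114 (1970), Props. 2.8, 2.9,
  Thm. 2.18 (iv). [JacquetLanglands1970]
* H. Jacquet, I. I. Piatetski-Shapiro, J. Shalika, *Rankin–Selberg convolutions*, Amer. J. Math.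
  105 (1983), Thm. 2.7 (iii), §2.10–2.11. [JacquetPiatetskiShapiroShalika1983]
-/

set_option autoImplicit false

noncomputable section

open scoped MatrixGroups NNReal
open MeasureTheory ValuativeRel Polynomial
  Literature.NumberTheory.GaloisRepresentations.IsNonarchimedeanLocalField

namespace Literature.NumberTheory.Automorphic

/-! ### Part 1: Fourier truncation of Kirillov functions -/

section Truncation

variable {F : Type*} [Field F] [ValuativeRel F] [TopologicalSpace F] [IsNonarchimedeanLocalField F]
  {V : Type*} [AddCommGroup V] [Module ℂ V] (π : Representation ℂ (GL (Fin 2) F) V)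

/-- **Fourier truncation in the Kirillov model** (Jacquet–Langlands 1970, Prop. 2.9 (i)).  For
`ψ` continuous non-trivial, `Λ` a `ψ`-Whittaker functional, `v` smooth, `a₀ ∈ F` and `r ∈ ℤ`
there are a finite set `R ⊆ F` and `C ≠ 0` with
`W_w(d(a,1)) = C · 1[a - a₀ ∈ 𝔭^r] · W_v(d(a,1))` for `w = ∑_{y ∈ R} ψ(-y a₀) π(n(y)) v`:
`W_w(d(a,1)) = (∑_y ψ(y (a - a₀))) W_v(d(a,1))` and the character sum over representatives of
`𝔭^j / 𝔭^{r'}` is `C · 1[a - a₀ ∈ 𝔭^r]` on the support of `W_v(d(·,1))`.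
[cite: JacquetLanglands1970, Prop. 2.9 (i)] -/
theorem exists_whittakerModel_sum_unipotentGL2_eq_indicator {ψ : AddChar F Circle}
    (hψ : ψ.IsContinuousNontrivial) {Λ : Module.Dual ℂ V} (hΛ : Λ ∈ whittakerFunctionals π ψ)
    {v : V} (hv : π.IsSmoothVector v) (a₀ : F) (r : ℤ) :
    ∃ (R : Finset F) (C : ℂ), C ≠ 0 ∧ ∀ a : Fˣ,
      whittakerModel π Λ (∑ y ∈ R, ((ψ (-(y * a₀)) : ℂ)) •
        π ((unipotentGL2 y : ↥(upperUnitriangular (Fin 2) F)) : GL (Fin 2) F) v) (diagGL2 a 1) =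
        C * {x : Fˣ | (x : F) - a₀ ∈ primePowBall F r}.indicator (fun _ => (1 : ℂ)) a *
          whittakerModel π Λ v (diagGL2 a 1) := by
  classical
  haveI : T2Space F :=
    (Literature.NumberTheory.GaloisRepresentations.IsNonarchimedeanLocalField.isLocalField F).toT2Space
  letI : MeasurableSpace F := borel F
  haveI : BorelSpace F := ⟨rfl⟩
  set μ : Measure F := Measure.addHaar with hμ
  obtain ⟨m, hm⟩ := hψ.exists_hasConductorExp
  obtain ⟨k, hk⟩ := exists_whittakerModel_diagGL2_eq_zero_of_not_mem π hψ hΛ hv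
  obtain ⟨k₀, hk₀⟩ := exists_mem_primePowBall (F := F) a₀
  set k₁ : ℤ := min k k₀ with hk₁
  set j : ℤ := m - r with hj
  set r' : ℤ := max j (m - k₁) with hr'
  obtain ⟨R, -, hdisj, hU⟩ :=
    exists_finset_primePowBall_eq_biUnion (F := F) (le_max_left j (m - k₁) : j ≤ r')
  set C : ℂ := (μ.real (primePowBall F j) : ℂ) * ((μ.real (primePowBall F r') : ℂ))⁻¹ with hC
  have hμr : (μ.real (primePowBall F r') : ℂ) ≠ 0 :=
    Complex.ofReal_ne_zero.2 (measureReal_primePowBall_ne_zero μ r')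
  have hCne : C ≠ 0 :=
    mul_ne_zero (Complex.ofReal_ne_zero.2 (measureReal_primePowBall_ne_zero μ j)) (inv_ne_zero hμr)
  refine ⟨R, C, hCne, fun a => ?_⟩
  have hsum : whittakerModel π Λ (∑ y ∈ R, ((ψ (-(y * a₀)) : ℂ)) •
      π ((unipotentGL2 y : ↥(upperUnitriangular (Fin 2) F)) : GL (Fin 2) F) v) (diagGL2 a 1) =
      (∑ y ∈ R, (ψ (y * ((a : F) - a₀)) : ℂ)) * whittakerModel π Λ v (diagGL2 a 1) := by
    rw [whittakerModel_sum_unipotentGL2_diagGL2 π hΛ v R (fun y => (ψ (-(y * a₀)) : ℂ)) a]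
    congr 1
    refine Finset.sum_congr rfl fun y _ => ?_
    rw [← Circle.coe_mul, ← AddChar.map_add_eq_mul]
    congr 2
    ring
  by_cases ha : (a : F) ∈ primePowBall F k
  · have hb : (a : F) - a₀ ∈ primePowBall F (m - r') := by
      have h1 : (a : F) - a₀ ∈ primePowBall F k₁ := by
        rw [sub_eq_add_neg]
        exact add_mem_primePowBall (primePowBall_antitone (min_le_left _ _) ha)
          (neg_mem_primePowBall (primePowBall_antitone (min_le_right _ _) hk₀))
      exact primePowBall_antitone (by have := le_max_right j (m - k₁); omega) h1
    have hchar := sum_addChar_mul_measureReal_eq μ hψ.1 hm hdisj hU hb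
    have hmj : m - j = r := by rw [hj]; ring
    rw [hmj] at hchar
    by_cases hr : (a : F) - a₀ ∈ primePowBall F r
    · rw [if_pos hr] at hchar
      have hS : (∑ y ∈ R, (ψ (y * ((a : F) - a₀)) : ℂ)) = C := by
        rw [hC, eq_mul_inv_iff_mul_eq₀ hμr, hchar]
      rw [hsum, hS, Set.indicator_of_mem (show a ∈ {x : Fˣ | (x : F) - a₀ ∈ primePowBall F r} from hr),
        mul_one]
    · rw [if_neg hr, mul_eq_zero] at hchar
      have hS : (∑ y ∈ R, (ψ (y * ((a : F) - a₀)) : ℂ)) = 0 := hchar.resolve_right hμr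
      rw [hsum, hS, zero_mul,
        Set.indicator_of_notMem (show a ∉ {x : Fˣ | (x : F) - a₀ ∈ primePowBall F r} from hr),
        mul_zero, zero_mul]
  · rw [hsum, hk a ha, mul_zero, mul_zero]

/-- **The Kirillov model contains the indicators `1_{U^j}` for all deep `j`** (Jacquet–Langlands
1970, Prop. 2.9 (i)): for `π` smooth, `ψ` continuous non-trivial and `Λ ≠ 0` a `ψ`-Whittaker
functional there is `M ≥ max(f, 1)` such that for every `j ≥ M` some `w_j ∈ V` has
`W_{w_j}(d(a, 1)) = 1_{U^j}(a)` — truncate a vector `v₀` with `Λ(v₀) ≠ 0` fixed by `d(U^M, 1)`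
to the ball `1 + 𝔭^j`. [cite: JacquetLanglands1970, Prop. 2.9 (i)] -/
theorem exists_forall_whittakerModel_diagGL2_eq_indicator_unitFiltration (hπ : π.IsSmooth)
    {ψ : AddChar F Circle} (hψ : ψ.IsContinuousNontrivial) {Λ : Module.Dual ℂ V}
    (hΛ : Λ ∈ whittakerFunctionals π ψ) (hΛ0 : Λ ≠ 0) (f : ℕ) :
    ∃ M : ℕ, f ≤ M ∧ 1 ≤ M ∧ ∀ j : ℕ, M ≤ j → ∃ w : V, ∀ a : Fˣ,
      whittakerModel π Λ w (diagGL2 a 1) = (unitFiltration F j).indicator (fun _ => (1 : ℂ)) a := by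
  classical
  obtain ⟨v₀, hv₀⟩ : ∃ v : V, Λ v ≠ 0 := by
    by_contra h
    push Not at h
    exact hΛ0 (LinearMap.ext h)
  obtain ⟨M₀, hM₀1, hM₀⟩ := exists_unitFiltration_diagGL2_apply_eq π (hπ v₀)
  refine ⟨max M₀ f, le_max_right _ _, hM₀1.trans (le_max_left _ _), fun j hj => ?_⟩
  have hj1 : 1 ≤ j := hM₀1.trans ((le_max_left _ _).trans hj)
  obtain ⟨R, C, hC, hw⟩ :=
    exists_whittakerModel_sum_unipotentGL2_eq_indicator π hψ hΛ (hπ v₀) 1 (j : ℤ)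
  refine ⟨(C * Λ v₀)⁻¹ • ∑ y ∈ R, ((ψ (-(y * 1)) : ℂ)) •
    π ((unipotentGL2 y : ↥(upperUnitriangular (Fin 2) F)) : GL (Fin 2) F) v₀, fun a => ?_⟩
  rw [map_smul, Pi.smul_apply, smul_eq_mul, hw a]
  by_cases ha : a ∈ unitFiltration F j
  · have h1 : (a : F) - 1 ∈ primePowBall F (j : ℤ) := (mem_unitFiltration_iff_sub_one_mem hj1 a).1 ha
    have hva : whittakerModel π Λ v₀ (diagGL2 a 1) = Λ v₀ := by
      have h := whittakerModel_diagGL2_diagGL2 π Λ v₀ 1 a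
      rw [hM₀ a (unitFiltration_antitone ((le_max_left _ _).trans hj) ha), one_mul] at h
      rw [← h, whittakerModel_apply, diagGL2_one, map_one, Module.End.one_apply]
    rw [Set.indicator_of_mem (show a ∈ {x : Fˣ | (x : F) - 1 ∈ primePowBall F (j : ℤ)} from h1),
      Set.indicator_of_mem ha, hva, mul_one]
    field_simp
  · have h1 : (a : F) - 1 ∉ primePowBall F (j : ℤ) := fun h =>
      ha ((mem_unitFiltration_iff_sub_one_mem hj1 a).2 h)
    rw [Set.indicator_of_notMem (show a ∉ {x : Fˣ | (x : F) - 1 ∈ primePowBall F (j : ℤ)} from h1),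
      Set.indicator_of_notMem ha, mul_zero, zero_mul, mul_zero]

end Truncation

/-! ### Part 2: polynomial calculus for an eigen-functional -/

section Polynomial

variable {V : Type*} [AddCommGroup V] [Module ℂ V] {K : Type*} [CommRing K] [Algebra ℂ K]

/-- If `Z (T v) = c Z(v)` for all `v` then `Z (Tⁿ v) = cⁿ Z(v)`. [folklore] -/
theorem apply_pow_eq_pow_mul (T : Module.End ℂ V) (Z : V →ₗ[ℂ] K) (c : K)
    (hZ : ∀ v, Z (T v) = c * Z v) (n : ℕ) (v : V) : Z ((T ^ n) v) = c ^ n * Z v := by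
  induction n generalizing v with
  | zero => simp
  | succ n ih => rw [pow_succ, Module.End.mul_apply, ih, hZ, pow_succ]; ring

/-- If `Z (T v) = c Z(v)` for all `v` then `Z (p(T) v) = p(c) Z(v)` for every polynomial `p`.
[folklore] -/
theorem apply_aeval_eq_aeval_mul (T : Module.End ℂ V) (Z : V →ₗ[ℂ] K) (c : K)
    (hZ : ∀ v, Z (T v) = c * Z v) (p : ℂ[X]) (v : V) :
    Z (aeval T p v) = aeval c p * Z v := by
  induction p using Polynomial.induction_on' with
  | add p q hp hq => rw [map_add, LinearMap.add_apply, map_add, hp, hq, map_add, add_mul]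
  | monomial n a =>
    rw [aeval_monomial, aeval_monomial, Module.End.mul_apply, Module.algebraMap_end_apply, map_smul,
      apply_pow_eq_pow_mul T Z c hZ, Algebra.smul_def, mul_assoc]

end Polynomial

/-! ### Part 3: the Jacquet-module step -/

section Jacquet

variable {F : Type*} [Field F] {V : Type*} [AddCommGroup V] [Module ℂ V]
  (π : Representation ℂ (GL (Fin 2) F) V)

/-- **A torus eigen-functional with transcendental eigenvalue that kills `V(N)` is zero.**  Let
`V_N` be finite-dimensional, `K ⊇ ℂ` a field, `Z : V → K` `ℂ`-linear with
`Z(π(d(t,1)) v) = e Z(v)` for some `t ∈ Fˣ` and `e ∈ K` transcendental over `ℂ`.  If `Z` vanishes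
on `V(N) = ker (V → V_N)` then `Z = 0`: for the characteristic polynomial `p` of `d(t, 1)` on
`V_N` (Cayley–Hamilton) `p(π(d(t,1))) v ∈ V(N)`, so `0 = Z(p(π(d(t,1))) v) = p(e) Z(v)` with
`p(e) ≠ 0`. (Jacquet–Langlands 1970, proof of Prop. 2.10, read over `ℂ(q^{-s})`.)
[cite: JacquetLanglands1970, Prop. 2.10] -/
theorem torusEquivariant_eq_zero_of_forall_mem_ker
    [FiniteDimensional ℂ (Representation.restrictUnipotentGL F (id : Fin 2 → Fin 2) π).Coinvariants]
    {K : Type*} [Field K] [Algebra ℂ K] {e : K} (he : Transcendental ℂ e) {t : Fˣ}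
    {Z : V →ₗ[ℂ] K} (hZ : ∀ v, Z (π (diagGL2 t 1) v) = e * Z v)
    (hvan : ∀ v ∈ Representation.Coinvariants.ker
      (Representation.restrictUnipotentGL F (id : Fin 2 → Fin 2) π), Z v = 0) :
    Z = 0 := by
  set T : Module.End ℂ (Representation.restrictUnipotentGL F (id : Fin 2 → Fin 2) π).Coinvariants :=
    Representation.jacquetGL F (id : Fin 2 → Fin 2) π
      (leviProjection F (id : Fin 2 → Fin 2) ⟨diagGL2 t 1, diagGL2_mem_standardParabolicGL_fin_two t 1⟩)
    with hT
  have hpe : aeval e T.charpoly ≠ 0 := fun h => he ⟨T.charpoly, T.charpoly_monic.ne_zero, h⟩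
  refine LinearMap.ext fun v => ?_
  have hmem : aeval (π (diagGL2 t 1)) T.charpoly v ∈ Representation.Coinvariants.ker
      (Representation.restrictUnipotentGL F (id : Fin 2 → Fin 2) π) := by
    rw [← Representation.Coinvariants.mk_eq_zero, mk_aeval_diagGL2, ← hT, LinearMap.aeval_self_charpoly,
      LinearMap.zero_apply]
  have h := hvan _ hmem
  rw [apply_aeval_eq_aeval_mul (π (diagGL2 t 1)) Z e hZ, mul_eq_zero] at h
  rw [LinearMap.zero_apply]
  exact h.resolve_left hpe

end Jacquet

/-! ### Part 4: functionals killing one indicator vector kill `V(N)` -/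

section Kernel

variable {F : Type*} [Field F] [ValuativeRel F] [TopologicalSpace F] [IsNonarchimedeanLocalField F]
  {V : Type*} [AddCommGroup V] [Module ℂ V] (π : Representation ℂ (GL (Fin 2) F) V)

/-- `U^N` is closed under inversion. [folklore] -/
private theorem inv_mem_unitFiltration_aux {N : ℕ} {x : Fˣ} (hx : x ∈ unitFiltration F N) :
    x⁻¹ ∈ unitFiltration F N := by
  obtain ⟨hx1, hx2⟩ := hx
  have hinv : normAbs F ((x⁻¹ : Fˣ) : F) = 1 := by
    rw [Units.val_inv_eq_inv_val, map_inv₀, hx1, inv_one]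
  refine ⟨hinv, ?_⟩
  have h : ((x⁻¹ : Fˣ) : F) - 1 = ((x⁻¹ : Fˣ) : F) * (-((x : F) - 1)) := by
    rw [Units.val_inv_eq_inv_val, neg_sub, mul_sub, mul_one, inv_mul_cancel₀ x.ne_zero]
  rw [h, map_mul, normAbs_neg, hinv, one_mul]
  exact hx2

/-- **Index relation** `Z(w_j) = [U^j : U^{j'}] · Z(w_{j'})`.  Let `Z : V → K` be `ℂ`-linear with
`Z(π(d(b,1)) v) = e(b) Z(v)`, `e = 1` on `U^f`, and let `w`, `w'` have Kirillov functions
`1_{U^j}`, `1_{U^{j'}}` with `max(f, 1) ≤ j ≤ j'`.  Then `Z(w) = n Z(w')` for some integer `n ≥ 1`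
(the number of cosets): `w = ∑_y π(d((1 + y)⁻¹, 1)) w'` over representatives `y` of
`𝔭^j / 𝔭^{j'}`, both sides having the Kirillov function `1_{U^j} = ∑_y 1_{(1+y) U^{j'}}`
(`kirillov_injective`). [cite: JacquetLanglands1970, Prop. 2.9 (i)] -/
theorem exists_apply_eq_natCast_mul_of_indicator [π.IsIrreducible] (hπ : π.IsSmooth)
    {ψ : AddChar F Circle} (hψ : ψ.IsContinuousNontrivial) {Λ : Module.Dual ℂ V}
    (hΛ : Λ ∈ whittakerFunctionals π ψ) (hΛ0 : Λ ≠ 0)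
    {K : Type*} [CommRing K] [Algebra ℂ K] {e : Fˣ → K} {f : ℕ}
    (he : ∀ u ∈ unitFiltration F f, e u = 1) {Z : V →ₗ[ℂ] K}
    (hZ : ∀ (b : Fˣ) (v : V), Z (π (diagGL2 b 1) v) = e b * Z v)
    {j j' : ℕ} (hfj : f ≤ j) (hj : 1 ≤ j) (hjj' : j ≤ j') {w w' : V}
    (hw : ∀ a : Fˣ, whittakerModel π Λ w (diagGL2 a 1) =
      (unitFiltration F j).indicator (fun _ => (1 : ℂ)) a)
    (hw' : ∀ a : Fˣ, whittakerModel π Λ w' (diagGL2 a 1) =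
      (unitFiltration F j').indicator (fun _ => (1 : ℂ)) a) :
    ∃ n : ℕ, n ≠ 0 ∧ Z w = (n : K) * Z w' := by
  classical
  obtain ⟨R, hR, hdisj, hU⟩ :=
    exists_finset_primePowBall_eq_biUnion (F := F) (show ((j : ℕ) : ℤ) ≤ ((j' : ℕ) : ℤ) by
      exact_mod_cast hjj')
  have hj'1 : 1 ≤ j' := hj.trans hjj'
  have hRmem : ∀ y ∈ R, y ∈ primePowBall F ((j : ℕ) : ℤ) := fun y hy => hR (Finset.mem_coe.2 hy)
  have hne : ∀ y ∈ R, (1 : F) + y ≠ 0 := fun y hy => TateDirect.one_add_ne_zero hj (hRmem y hy)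
  -- the units `1 + y`
  set u : F → Fˣ := fun y => if h : (1 : F) + y ≠ 0 then Units.mk0 (1 + y) h else 1 with hu
  have hu_eq : ∀ (y : F) (hy : y ∈ R), u y = Units.mk0 (1 + y) (hne y hy) := fun y hy => by
    simp only [hu, dif_pos (hne y hy)]
  have hu_mem : ∀ y ∈ R, u y ∈ unitFiltration F j := fun y hy => by
    rw [hu_eq y hy]
    exact TateDirect.one_add_mem_unitFiltration hj (hRmem y hy) (hne y hy)
  have hu_val : ∀ y ∈ R, ((u y : Fˣ) : F) = 1 + y := fun y hy => by rw [hu_eq y hy, Units.val_mk0]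
  -- `a (1 + y)⁻¹ ∈ U^{j'} ↔ (a - 1) - y ∈ 𝔭^{j'}`
  have hmem_iff : ∀ y ∈ R, ∀ a : Fˣ,
      a * (u y)⁻¹ ∈ unitFiltration F j' ↔ ((a : F) - 1) - y ∈ primePowBall F ((j' : ℕ) : ℤ) := by
    intro y hy a
    rw [mem_unitFiltration_iff_sub_one_mem hj'1]
    have hnorm : normAbs F ((u y : Fˣ) : F) = (residueFieldCard F : ℝ≥0)⁻¹ ^ (0 : ℤ) := by
      rw [zpow_zero]; exact (hu_mem y hy).1
    have hcalc : ((u y : Fˣ) : F) * ((((a * (u y)⁻¹ : Fˣ)) : F) - 1) = ((a : F) - 1) - y := by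
      have hne' := hne y hy
      rw [Units.val_mul, Units.val_inv_eq_inv_val, hu_val y hy]
      field_simp
      ring
    have key := mul_mem_primePowBall_iff hnorm (m := ((j' : ℕ) : ℤ)) (x := (((a * (u y)⁻¹ : Fˣ)) : F) - 1)
    rw [sub_zero, hcalc] at key
    rw [← key]
  -- the indicator identity `1_{U^j}(a) = ∑_y 1_{U^{j'}}(a (1+y)⁻¹)`
  have hind : ∀ a : Fˣ, (unitFiltration F j).indicator (fun _ => (1 : ℂ)) a =
      ∑ y ∈ R, (unitFiltration F j').indicator (fun _ => (1 : ℂ)) (a * (u y)⁻¹) := by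
    intro a
    by_cases haj : a ∈ unitFiltration F j
    · have h1 : (a : F) - 1 ∈ primePowBall F ((j : ℕ) : ℤ) :=
        (mem_unitFiltration_iff_sub_one_mem hj a).1 haj
      have h1' : (a : F) - 1 ∈ ⋃ y ∈ R, {x : F | x - y ∈ primePowBall F ((j' : ℕ) : ℤ)} := hU ▸ h1
      obtain ⟨y₀, hy₀, hy₀'⟩ := Set.mem_iUnion₂.1 h1'
      have hy₀'' : ((a : F) - 1) - y₀ ∈ primePowBall F ((j' : ℕ) : ℤ) := hy₀'
      have hterm : ∀ y ∈ R, (unitFiltration F j').indicator (fun _ => (1 : ℂ)) (a * (u y)⁻¹) =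
          if y = y₀ then 1 else 0 := by
        intro y hy
        by_cases hyy : y = y₀
        · rw [if_pos hyy, Set.indicator_of_mem]
          rw [hmem_iff y hy, hyy]
          exact hy₀''
        · rw [if_neg hyy, Set.indicator_of_notMem]
          intro hmem
          have h2 : ((a : F) - 1) - y ∈ primePowBall F ((j' : ℕ) : ℤ) := (hmem_iff y hy a).1 hmem
          refine hdisj y₀ hy₀ y hy (Ne.symm hyy) ?_
          have : y₀ - y = (((a : F) - 1) - y) - (((a : F) - 1) - y₀) := by ring
          rw [this, sub_eq_add_neg]
          exact add_mem_primePowBall h2 (neg_mem_primePowBall hy₀'')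
      rw [Set.indicator_of_mem haj, Finset.sum_congr rfl hterm, Finset.sum_ite_eq' R y₀, if_pos hy₀]
    · rw [Set.indicator_of_notMem haj]
      symm
      refine Finset.sum_eq_zero fun y hy => Set.indicator_of_notMem (fun hmem => haj ?_) _
      have h2 : ((a : F) - 1) - y ∈ primePowBall F ((j' : ℕ) : ℤ) := (hmem_iff y hy a).1 hmem
      refine (mem_unitFiltration_iff_sub_one_mem hj a).2 ?_
      have : (a : F) - 1 = (((a : F) - 1) - y) + y := by ring
      rw [this]
      exact add_mem_primePowBall (primePowBall_antitone (by exact_mod_cast hjj') h2) (hRmem y hy)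
  -- the vector identity, by injectivity of the Kirillov map
  have hvec : w = ∑ y ∈ R, π (diagGL2 (u y)⁻¹ 1) w' := by
    refine kirillov_injective π hπ hψ hΛ hΛ0 (funext fun a => ?_)
    simp only
    rw [hw a, hind a, map_sum, Finset.sum_apply]
    refine Finset.sum_congr rfl fun y _ => ?_
    rw [whittakerModel_diagGL2_diagGL2, hw']
  -- apply `Z`
  have hRne : R.Nonempty := by
    have h0 : (0 : F) ∈ ⋃ y ∈ R, {x : F | x - y ∈ primePowBall F ((j' : ℕ) : ℤ)} :=
      hU ▸ zero_mem_primePowBall _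
    obtain ⟨y, hy, -⟩ := Set.mem_iUnion₂.1 h0
    exact ⟨y, hy⟩
  refine ⟨R.card, Finset.card_ne_zero.2 hRne, ?_⟩
  rw [hvec, map_sum]
  have hterm : ∀ y ∈ R, Z (π (diagGL2 (u y)⁻¹ 1) w') = Z w' := fun y hy => by
    rw [hZ, he _ (inv_mem_unitFiltration_aux (unitFiltration_antitone hfj (hu_mem y hy))), one_mul]
  rw [Finset.sum_congr rfl hterm, Finset.sum_const, nsmul_eq_mul]

/-- **A torus eigen-functional that kills `w_M` kills `V(N)`** (Jacquet–Langlands 1970,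
Props. 2.8–2.9: `V(N)` is carried into `𝒮(Fˣ)`, which is spanned by translates of the `1_{U^j}`).
With `Z`, `e`, `f ≤ M`, `1 ≤ M` as above, vectors `w_j` with Kirillov function `1_{U^j}` for all
`j ≥ M` and `Z(w_M) = 0`: for `v ∈ V(N)` the Kirillov function `a ↦ W_v(d(a,1))` vanishes off an
annulus `𝔭^{k_lo} ∖ 𝔭^{k_hi}` and is invariant under a deep `U^{N_v}`, so `v` is a finite
combination `∑_y W_v(d(y,1)) π(d(y⁻¹, 1)) w_{j_y}` over representatives `y` of
`𝔭^{k_lo} / 𝔭^{r}` (Kirillov injectivity), each term killed by `Z`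
(`exists_apply_eq_natCast_mul_of_indicator`). [cite: JacquetLanglands1970, Prop. 2.9 (i)] -/
theorem torusEquivariant_apply_eq_zero_of_mem_ker [π.IsIrreducible] (hπ : π.IsSmooth)
    {ψ : AddChar F Circle} (hψ : ψ.IsContinuousNontrivial) {Λ : Module.Dual ℂ V}
    (hΛ : Λ ∈ whittakerFunctionals π ψ) (hΛ0 : Λ ≠ 0)
    {K : Type*} [Field K] [Algebra ℂ K] {e : Fˣ → K} {f : ℕ}
    (he : ∀ u ∈ unitFiltration F f, e u = 1) {M : ℕ} (hfM : f ≤ M) (h1M : 1 ≤ M)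
    (hwM : ∀ j : ℕ, M ≤ j → ∃ w : V, ∀ a : Fˣ, whittakerModel π Λ w (diagGL2 a 1) =
      (unitFiltration F j).indicator (fun _ => (1 : ℂ)) a)
    {w : V} (hw : ∀ a : Fˣ, whittakerModel π Λ w (diagGL2 a 1) =
      (unitFiltration F M).indicator (fun _ => (1 : ℂ)) a)
    {Z : V →ₗ[ℂ] K} (hZ : ∀ (b : Fˣ) (v : V), Z (π (diagGL2 b 1) v) = e b * Z v) (hZw : Z w = 0)
    {v : V} (hv : v ∈ Representation.Coinvariants.ker
      (Representation.restrictUnipotentGL F (id : Fin 2 → Fin 2) π)) :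
    Z v = 0 := by
  classical
  haveI : CharZero K := charZero_of_injective_algebraMap (algebraMap ℂ K).injective
  -- Step 1: `Z` kills every `w_j`, `j ≥ M`
  choose! wv hwv using hwM
  have hZj : ∀ j : ℕ, M ≤ j → Z (wv j) = 0 := fun j hj => by
    obtain ⟨n, hn, h⟩ :=
      exists_apply_eq_natCast_mul_of_indicator π hπ hψ hΛ hΛ0 he hZ hfM h1M hj hw (hwv j hj)
    rw [hZw, eq_comm, mul_eq_zero] at h
    exact h.resolve_left (Nat.cast_ne_zero.2 hn)
  -- Step 2: the Kirillov function of `v`: level, support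
  obtain ⟨Nv, -, hfix⟩ := exists_unitFiltration_diagGL2_apply_eq π (hπ v)
  obtain ⟨khi, hkhi⟩ := exists_whittakerModel_diagGL2_eq_zero_of_mem_ker π hψ hΛ hv
  obtain ⟨klo', hklo'⟩ := exists_whittakerModel_diagGL2_eq_zero_of_not_mem π hψ hΛ (hπ v)
  set klo : ℤ := min klo' khi with hklo_def
  have hklo : ∀ a : Fˣ, (a : F) ∉ primePowBall F klo → whittakerModel π Λ v (diagGL2 a 1) = 0 :=
    fun a ha => hklo' a fun h => ha (primePowBall_antitone (min_le_left _ _) h)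
  set j : ℕ := max M Nv with hj_def
  set r : ℤ := khi + j with hr_def
  have hklo_khi : klo ≤ khi := min_le_right _ _
  have hkhi_r : khi ≤ r := by rw [hr_def]; omega
  obtain ⟨R, hR, hdisj, hU⟩ :=
    exists_finset_primePowBall_eq_biUnion (F := F) (hklo_khi.trans hkhi_r : klo ≤ r)
  have hRmem : ∀ y ∈ R, y ∈ primePowBall F klo := fun y hy => hR (Finset.mem_coe.2 hy)
  -- the orders `ord y`, units `uy y`, depths `jy y` and coefficients `c y`
  have hordex : ∀ y : F, ∃ o : ℤ, y ≠ 0 → normAbs F y = (residueFieldCard F : ℝ≥0)⁻¹ ^ o := by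
    intro y
    by_cases hy : y = 0
    · exact ⟨0, fun h => (h hy).elim⟩
    · obtain ⟨o, ho⟩ := exists_normAbs_eq_inv_zpow hy
      exact ⟨o, fun _ => ho⟩
  choose ord hord using hordex
  set uy : F → Fˣ := fun y => if h : y ≠ 0 then Units.mk0 y h else 1 with huy_def
  set jy : F → ℕ := fun y => (r - ord y).toNat with hjy_def
  set c : F → ℂ := fun y =>
    if y ∉ primePowBall F khi then whittakerModel π Λ v (diagGL2 (uy y) 1) else 0 with hc_def
  -- facts about a representative `y` off `𝔭^{k_hi}`
  have hy0 : ∀ y : F, y ∉ primePowBall F khi → y ≠ 0 := fun y hy h =>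
    hy (h ▸ zero_mem_primePowBall khi)
  have huy_eq : ∀ (y : F) (hy : y ∉ primePowBall F khi), uy y = Units.mk0 y (hy0 y hy) := fun y hy => by
    simp only [huy_def, dif_pos (hy0 y hy)]
  have huy_val : ∀ y : F, y ∉ primePowBall F khi → ((uy y : Fˣ) : F) = y := fun y hy => by
    rw [huy_eq y hy, Units.val_mk0]
  have hordy : ∀ y : F, y ∉ primePowBall F khi →
      normAbs F y = (residueFieldCard F : ℝ≥0)⁻¹ ^ ord y := fun y hy => hord y (hy0 y hy)
  have hord_lt : ∀ y : F, y ∉ primePowBall F khi → ord y < khi := fun y hy => by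
    rw [mem_primePowBall_iff, hordy y hy, inv_residueFieldCard_zpow_le_iff, not_le] at hy
    exact hy
  have hjy : ∀ y : F, y ∉ primePowBall F khi → ((jy y : ℕ) : ℤ) = r - ord y ∧ j + 1 ≤ jy y := by
    intro y hy
    have hlt := hord_lt y hy
    have h1 : ((jy y : ℕ) : ℤ) = r - ord y := by
      rw [hjy_def]
      exact Int.toNat_of_nonneg (by omega)
    exact ⟨h1, by omega⟩
  have hy_r : ∀ y : F, y ∉ primePowBall F khi → y ∉ primePowBall F r := fun y hy h =>
    hy (primePowBall_antitone hkhi_r h)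
  -- `a / y ∈ U^{j_y} ↔ a - y ∈ 𝔭^r`
  have hmem_iff : ∀ y : F, y ∉ primePowBall F khi → ∀ a : Fˣ,
      a * (uy y)⁻¹ ∈ unitFiltration F (jy y) ↔ (a : F) - y ∈ primePowBall F r := by
    intro y hy a
    constructor
    · intro h
      have h' : a * (uy y)⁻¹ ∈ unitFiltration F (r - ord y).toNat := h
      have key := (TateDirect.coe_mul_sub_mem_iff (hordy y hy) h' ((hord_lt y hy).trans_le hkhi_r) y).2
        (by rw [sub_self]; exact zero_mem_primePowBall r)
      have hval : (((a * (uy y)⁻¹ : Fˣ)) : F) * y = (a : F) := by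
        rw [Units.val_mul, Units.val_inv_eq_inv_val, huy_val y hy,
          inv_mul_cancel_right₀ (hy0 y hy)]
      rwa [hval] at key
    · intro h
      have key := (TateDirect.div_mem_unitFiltration (hy_r y hy) (hordy y hy) h (hy0 y hy) a.ne_zero).2
      rw [Units.mk0_val, ← huy_eq y hy] at key
      exact key
  -- Step 3: `v` is a combination of torus translates of the `w_{j_y}`
  have hvec : v = ∑ y ∈ R, c y • π (diagGL2 (uy y)⁻¹ 1) (wv (jy y)) := by
    refine kirillov_injective π hπ hψ hΛ hΛ0 (funext fun a => ?_)
    simp only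
    rw [map_sum, Finset.sum_apply]
    have hterm : ∀ y ∈ R, whittakerModel π Λ (c y • π (diagGL2 (uy y)⁻¹ 1) (wv (jy y))) (diagGL2 a 1) =
        if y ∉ primePowBall F khi then
          whittakerModel π Λ v (diagGL2 (uy y) 1) *
            (unitFiltration F (jy y)).indicator (fun _ => (1 : ℂ)) (a * (uy y)⁻¹)
        else 0 := by
      intro y _
      rw [map_smul, Pi.smul_apply, smul_eq_mul, whittakerModel_diagGL2_diagGL2]
      by_cases hy : y ∉ primePowBall F khi
      · rw [if_pos hy, hwv (jy y) ((le_max_left M Nv).trans (by have := (hjy y hy).2; omega)),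
          hc_def]
        simp only [if_pos hy]
      · rw [if_neg hy, hc_def]
        simp only [if_neg hy, zero_mul]
    rw [Finset.sum_congr rfl hterm]
    by_cases ha : (a : F) ∈ primePowBall F klo
    · -- `a` lies in exactly one translate `y₀ + 𝔭^r`
      have ha' : (a : F) ∈ ⋃ y ∈ R, {x : F | x - y ∈ primePowBall F r} := hU ▸ ha
      obtain ⟨y₀, hy₀, hy₀'⟩ := Set.mem_iUnion₂.1 ha'
      have hy₀'' : (a : F) - y₀ ∈ primePowBall F r := hy₀'
      have huniq : ∀ y ∈ R, (a : F) - y ∈ primePowBall F r → y = y₀ := by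
        intro y hy h
        by_contra hne
        refine hdisj y₀ hy₀ y hy (Ne.symm hne) ?_
        have : y₀ - y = ((a : F) - y) - ((a : F) - y₀) := by ring
        rw [this, sub_eq_add_neg]
        exact add_mem_primePowBall h (neg_mem_primePowBall hy₀'')
      have hterm' : ∀ y ∈ R, (if y ∉ primePowBall F khi then
          whittakerModel π Λ v (diagGL2 (uy y) 1) *
            (unitFiltration F (jy y)).indicator (fun _ => (1 : ℂ)) (a * (uy y)⁻¹) else 0) =
          if y = y₀ then c y₀ else 0 := by
        intro y hy
        by_cases hyk : y ∉ primePowBall F khi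
        · rw [if_pos hyk]
          by_cases hyy : y = y₀
          · subst hyy
            rw [if_pos rfl, hc_def]
            simp only [if_pos hyk]
            rw [Set.indicator_of_mem ((hmem_iff y hyk a).2 hy₀''), mul_one]
          · rw [if_neg hyy, Set.indicator_of_notMem, mul_zero]
            exact fun hmem => hyy (huniq y hy ((hmem_iff y hyk a).1 hmem))
        · rw [if_neg hyk]
          by_cases hyy : y = y₀
          · subst hyy
            rw [if_pos rfl, hc_def]
            simp only [if_neg hyk]
          · rw [if_neg hyy]
      rw [Finset.sum_congr rfl hterm', Finset.sum_ite_eq' R y₀, if_pos hy₀, hc_def]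
      simp only
      by_cases hy₀k : y₀ ∉ primePowBall F khi
      · rw [if_pos hy₀k]
        -- `W_v(d(a,1)) = W_v(d(y₀,1))` as `a / y₀ ∈ U^{j_{y₀}} ⊆ U^{N_v}` fixes `v`
        have hmem : a * (uy y₀)⁻¹ ∈ unitFiltration F (jy y₀) := (hmem_iff y₀ hy₀k a).2 hy₀''
        have hmem' : a * (uy y₀)⁻¹ ∈ unitFiltration F Nv :=
          unitFiltration_antitone ((le_max_right M Nv).trans (by have := (hjy y₀ hy₀k).2; omega)) hmem
        have h := whittakerModel_diagGL2_diagGL2 π Λ v (uy y₀) (a * (uy y₀)⁻¹)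
        rw [hfix _ hmem', mul_comm a, ← mul_assoc, mul_inv_cancel, one_mul] at h
        exact h.symm
      · rw [if_neg hy₀k]
        refine hkhi a ?_
        have : (a : F) = ((a : F) - y₀) + y₀ := by ring
        rw [this]
        exact add_mem_primePowBall (primePowBall_antitone hkhi_r hy₀'') (not_not.1 hy₀k)
    · -- off `𝔭^{k_lo}` everything vanishes
      rw [hklo a ha]
      symm
      refine Finset.sum_eq_zero fun y hy => ?_
      by_cases hyk : y ∉ primePowBall F khi
      · rw [if_pos hyk, Set.indicator_of_notMem, mul_zero]
        intro hmem
        apply ha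
        have h := (hmem_iff y hyk a).1 hmem
        have : (a : F) = ((a : F) - y) + y := by ring
        rw [this]
        exact add_mem_primePowBall (primePowBall_antitone (hklo_khi.trans hkhi_r) h) (hRmem y hy)
      · rw [if_neg hyk]
  -- Step 4: apply `Z`
  rw [hvec, map_sum]
  refine Finset.sum_eq_zero fun y _ => ?_
  rw [map_smul, hZ]
  by_cases hyk : y ∉ primePowBall F khi
  · rw [hZj (jy y) ((le_max_left M Nv).trans (by have := (hjy y hyk).2; omega)), mul_zero, smul_zero]
  · rw [hc_def]
    simp only [if_neg hyk, zero_smul]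

end Kernel

/-! ### Part 5: the line of torus-equivariant functionals -/

section Main

variable {F : Type*} [Field F] [ValuativeRel F] [TopologicalSpace F] [IsNonarchimedeanLocalField F]
  {V : Type*} [AddCommGroup V] [Module ℂ V] (π : Representation ℂ (GL (Fin 2) F) V)

/-- **Torus-equivariant functionals are detected by one vector** (the uniqueness principle behind
Jacquet–Langlands 1970, Thm. 2.18 (iv) / JPSS 1983, Thm. 2.7 (iii) for `GL₂ × GL₁`).  Let `π` be
irreducible smooth with finite-dimensional Jacquet module, `ψ` continuous non-trivial, `Λ ≠ 0` a
`ψ`-Whittaker functional, `K ⊇ ℂ` a field and `e : Fˣ → K` equal to `1` on `U^f` with `e(t)`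
transcendental over `ℂ` for some `t`.  There are `M ≥ max(f, 1)` and `w ∈ V` with Kirillov
function `1_{U^M}` such that every `ℂ`-linear `Z : V → K` with `Z(π(d(b,1)) v) = e(b) Z(v)` and
`Z(w) = 0` is zero. [cite: JacquetLanglands1970, Thm. 2.18 (iv)] -/
theorem exists_testVector_forall_torusEquivariant_eq_zero [π.IsIrreducible] (hπ : π.IsSmooth)
    {ψ : AddChar F Circle} (hψ : ψ.IsContinuousNontrivial) {Λ : Module.Dual ℂ V}
    (hΛ : Λ ∈ whittakerFunctionals π ψ) (hΛ0 : Λ ≠ 0)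
    [FiniteDimensional ℂ (Representation.restrictUnipotentGL F (id : Fin 2 → Fin 2) π).Coinvariants]
    {K : Type*} [Field K] [Algebra ℂ K] {e : Fˣ → K} {f : ℕ}
    (he : ∀ u ∈ unitFiltration F f, e u = 1) {t : Fˣ} (ht : Transcendental ℂ (e t)) :
    ∃ (w : V) (M : ℕ), f ≤ M ∧ 1 ≤ M ∧
      (∀ a : Fˣ, whittakerModel π Λ w (diagGL2 a 1) =
        (unitFiltration F M).indicator (fun _ => (1 : ℂ)) a) ∧
      ∀ Z : V →ₗ[ℂ] K, (∀ (b : Fˣ) (v : V), Z (π (diagGL2 b 1) v) = e b * Z v) →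
        Z w = 0 → Z = 0 := by
  obtain ⟨M, hfM, h1M, hwM⟩ :=
    exists_forall_whittakerModel_diagGL2_eq_indicator_unitFiltration π hπ hψ hΛ hΛ0 f
  obtain ⟨w, hw⟩ := hwM M le_rfl
  exact ⟨w, M, hfM, h1M, hw, fun Z hZ hZw =>
    torusEquivariant_eq_zero_of_forall_mem_ker π ht (fun v => hZ t v) fun v hv =>
      torusEquivariant_apply_eq_zero_of_mem_ker π hπ hψ hΛ hΛ0 he hfM h1M hwM hw hZ hZw hv⟩

/-- **Any two torus-equivariant functionals are proportional** (same hypotheses): with the test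
vector `w` of `exists_testVector_forall_torusEquivariant_eq_zero`,
`Z₂(w) Z₁(v) = Z₁(w) Z₂(v)` for all `v`, i.e. `dim_K {Z | Z(π(d(b,1)) v) = e(b) Z(v)} ≤ 1` — the
`GL₂ × GL₁` case of the uniqueness of quasi-invariant functionals underlying the local functional
equation. [cite: JacquetLanglands1970, Thm. 2.18 (iv)]
[cite: JacquetPiatetskiShapiroShalika1983, Thm. 2.7 (iii)] -/
theorem torusEquivariant_proportional [π.IsIrreducible] (hπ : π.IsSmooth)
    {ψ : AddChar F Circle} (hψ : ψ.IsContinuousNontrivial) {Λ : Module.Dual ℂ V}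
    (hΛ : Λ ∈ whittakerFunctionals π ψ) (hΛ0 : Λ ≠ 0)
    [FiniteDimensional ℂ (Representation.restrictUnipotentGL F (id : Fin 2 → Fin 2) π).Coinvariants]
    {K : Type*} [Field K] [Algebra ℂ K] {e : Fˣ → K} {f : ℕ}
    (he : ∀ u ∈ unitFiltration F f, e u = 1) {t : Fˣ} (ht : Transcendental ℂ (e t)) :
    ∃ (w : V) (M : ℕ), f ≤ M ∧ 1 ≤ M ∧
      (∀ a : Fˣ, whittakerModel π Λ w (diagGL2 a 1) =
        (unitFiltration F M).indicator (fun _ => (1 : ℂ)) a) ∧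
      ∀ Z₁ Z₂ : V →ₗ[ℂ] K, (∀ (b : Fˣ) (v : V), Z₁ (π (diagGL2 b 1) v) = e b * Z₁ v) →
        (∀ (b : Fˣ) (v : V), Z₂ (π (diagGL2 b 1) v) = e b * Z₂ v) →
        ∀ v : V, Z₂ w * Z₁ v = Z₁ w * Z₂ v := by
  obtain ⟨w, M, hfM, h1M, hw, hmain⟩ :=
    exists_testVector_forall_torusEquivariant_eq_zero π hπ hψ hΛ hΛ0 he ht
  refine ⟨w, M, hfM, h1M, hw, fun Z₁ Z₂ hZ₁ hZ₂ v => ?_⟩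
  have hZ : ∀ (b : Fˣ) (v : V), (Z₂ w • Z₁ - Z₁ w • Z₂) (π (diagGL2 b 1) v) =
      e b * (Z₂ w • Z₁ - Z₁ w • Z₂) v := fun b v => by
    simp only [LinearMap.sub_apply, LinearMap.smul_apply, smul_eq_mul, hZ₁, hZ₂]
    ring
  have h0 : (Z₂ w • Z₁ - Z₁ w • Z₂) w = 0 := by
    simp only [LinearMap.sub_apply, LinearMap.smul_apply, smul_eq_mul]
    ring
  have h := congrArg (fun Z : V →ₗ[ℂ] K => Z v) (hmain _ hZ h0)
  simp only [LinearMap.sub_apply, LinearMap.smul_apply, smul_eq_mul, LinearMap.zero_apply,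
    sub_eq_zero] at h
  exact h

end Main

end Literature.NumberTheory.Automorphic

end
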